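import Summits.HodgeConjecture.HodgeConjecture.Theorems.MarkmanPartnerTransportPartnerExistenceLatticeTransc
import Summits.HodgeConjecture.HodgeConjecture.Theorems.MarkmanPartnerTransportPartnerExistenceInverse
import Literature.AlgebraicGeometry.HodgeTheory.LefschetzOneOneHolds
import Mathlib.LinearAlgebra.BilinearForm.Orthogonal

/-!
# Route MarkmanPartnerTransport · support `PartnerTransport` (stmt-HodgeConjecture-19650) —
# lattice helpers on the marked Hilbert square: the class `δ`, the shape of `T_ℚ(S^{[2]})`,
# complexified rational isometries of `(Λ_{K3} ⊕ ⟨−2⟩)_ℚ`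

For a marked smooth projective fourfold `(H, φ_H, P_H, (x, 0))` whose period has NO `δ`-component — the
shape of Beauville's marking of a Hilbert square `S^{[2]}` (`Beauville1983_hilbertSquare_markedIncidence`):

* `delta_mem_algebraicClasses` — the class `δ = φ_H⁻¹(0, 1)` is algebraic (rational and `q`-orthogonal
  to the period and its conjugate, i.e. of type `(1,1)` by (m5); Lefschetz `(1,1)`,
  `lefschetzOneOne_rational_holds`);
* `apply_inr_eq_zero_of_mem_ratTransc`, `ratCast_eq_sumElim_of_mem_ratTransc` — hence every vector of
  the rational transcendental space `T_ℚ = N_ℚ^⊥ ⊂ ℚ²³` (`…PartnerExistenceLattice`) has vanishing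
  `δ`-coordinate: `T_ℚ ⊂ Λ_{K3,ℚ} ⊕ 0`;
* `exists_ratLinear_of_forall_ratCast`, `eq_on_span_ratCast` — a `ℂ`-linear map `ℂ²² → ℂ²³` carrying
  `ℚ²²` into `ℚ²³` is the complexification of a `ℚ`-linear map, and two `ℂ`-linear maps agreeing on a
  set of rational vectors agree on its complex span;
* `k3HilbertForm_cplx_cplx`, `cplx_symm_cplx`, `cplx_cplx_symm` — the complexification
  `Matrix.toLin' ((toMatrix' τ) ⊗ ℂ)` of a rational isometry `τ ∈ O(ℚ²³, q)` is a `q`-isometry of `ℂ²³`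
  with inverse the complexification of `τ⁻¹`.

Pure linear algebra for the Witt-extension step of `PartnerTransport` (ROUTE-P1D §3.2, recipe A step 2).
No definition, no sorry, no named fact. Prover seat hodge-nonav-19652-p1 (gen 6),
`--supports stmt-HodgeConjecture-19650`.

References: A. Beauville, J. Differential Geom. 18 (1983) §6 Prop. 6, §9 Lemme 1 / Rem. 1;
D. Huybrechts, *Lectures on K3 Surfaces*, Ch. 3 §2–3; J.-P. Serre, *A Course in Arithmetic* IV §1.
-/

noncomputable section

set_option linter.dupNamespace false

open scoped Matrix
open Module CategoryTheory
open Literature.AlgebraicTopology.SingularHomology Literature.Geometry.Kaehler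
open Literature.AlgebraicGeometry Literature.AlgebraicGeometry.Motives Literature.AlgebraicGeometry.HodgeTheory
open Literature.AlgebraicGeometry.Hyperkaehler Literature.AlgebraicGeometry.Surfaces
open Summit.HodgeConjecture.HodgeConjecture.Theorems.NikulinTwinTransport
open Summit.HodgeConjecture.HodgeConjecture.Theorems.MarkmanPartnerTransport.BBFPositivity

namespace Summit.HodgeConjecture.HodgeConjecture.Theorems.MarkmanPartnerTransport.PartnerLattice

/-- `MarkedK3Sq[X, φ, P, z]`: VERBATIM the `let MarkedK3Sq := …` binder of the route declarations of
MarkmanPartnerTransport (clauses (m1)–(m6)). Local notation only. -/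
local notation3 (prettyPrint := false) "MarkedK3Sq[" X ", " φ ", " P ", " z "]" =>
  (((IsIntegralClass P ∧ ∀ Q : complexBetti X (2 * 4), IsIntegralClass Q → ∃ n : ℤ, Q = n • P) ∧
    (∀ c : complexBetti X 2, IsIntegralClass c ↔ ∃ v : K3HilbertIndex → ℤ, φ c = fun i => (v i : ℂ)) ∧
    (∀ a : complexBetti X 2, cupPowTwo a 4 = ((3 : ℂ) * (k3HilbertForm 2 (φ a) (φ a)) ^ 2) • P) ∧
    (IsOfHodgeType 4 X 2 2 0 (LinearEquiv.symm φ z) ∧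
      ∀ τ : complexBetti X 2, IsOfHodgeType 4 X 2 2 0 τ → ∃ t : ℂ, τ = t • LinearEquiv.symm φ z) ∧
    (∀ c : complexBetti X 2, IsOfHodgeType 4 X 2 1 1 c ↔
      (k3HilbertForm 2 (φ c) z = 0 ∧ k3HilbertForm 2 (φ c) (star z) = 0)) ∧
    (k3HilbertForm 2 z z = 0 ∧ 0 < (k3HilbertForm 2 (star z) z).re)))

/-- `qQ` = the rational Beauville–Bogomolov form of `K3^{[2]}`-type on `ℚ²³`. Local notation only. -/
local notation3 (prettyPrint := false) "qQ" => Matrix.toBilin' (Matrix.map (k3HilbertGram 2) (Int.cast : ℤ → ℚ))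

/-- `cz[τ]` = the complexification of a `ℚ`-linear `τ : ℚ²³ → ℚ²³`. Local notation only. -/
local notation3 (prettyPrint := false) "cz[" τ "]" =>
  Matrix.toLin' (Matrix.map (LinearMap.toMatrix' (R := ℚ) τ) (Rat.cast : ℚ → ℂ))

/-! ### The `δ`-direction of a Hilbert-square marking -/

/-- The rational vector `e_δ = (0, 1)` of `ℚ²³` read in `ℂ²³`. [folklore] -/
theorem ratCast_single_inr :
    (fun i => ((Pi.single (Sum.inr ()) (1 : ℚ) : K3HilbertIndex → ℚ) i : ℂ)) =
      (Sum.elim 0 1 : K3HilbertIndex → ℂ) := by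
  funext i
  rcases i with i | i
  · simp
  · obtain rfl : i = () := rfl
    simp

/-- `q(e_δ, t) = −2 · t_δ` on `ℚ²³` (`δ² = −2`, `δ ⟂ Λ_{K3}`). [cite: Beauville1983, §9 Lemme 1 and Rem. 1] -/
theorem qQ_single_inr_left (t : K3HilbertIndex → ℚ) :
    qQ (Pi.single (Sum.inr ()) 1) t = -2 * t (Sum.inr ()) := by
  rw [Matrix.toBilin'_apply', single_dotProduct, one_mul, Matrix.mulVec, dotProduct,
    Fintype.sum_sum_type]
  simp [Matrix.map_apply, k3HilbertGram_inr_inl, k3HilbertGram_two_inr_inr]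

variable {H : SchemeOver ℂ} {φH : complexBetti H 2 ≃ₗ[ℂ] (K3HilbertIndex → ℂ)}
  {PH : complexBetti H (2 * 4)} {x : K3Index → ℂ} {NH : Submodule ℚ (K3HilbertIndex → ℚ)}

/-- **The class `δ = φ_H⁻¹(0, 1)` of a fourfold marked with period `(x, 0)` is algebraic**: it is
rational, and `q((0,1), (x,0)) = q((0,1), (x̄,0)) = 0` makes it of type `(1,1)` by (m5), so Lefschetz
`(1,1)` applies (`lefschetzOneOne_rational_holds`). For `H = S^{[2]}` this is half the class of the
exceptional divisor. [cite: Beauville1983, §6 Prop. 6 and Remarque] [cite: VoisinHodgeI2002, Thm. 11.30] -/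
theorem delta_mem_algebraicClasses (hH : IsSmoothProjective 4 H) (hMH : MarkedK3Sq[H, φH, PH, Sum.elim x 0]) :
    φH.symm (Sum.elim 0 1) ∈ algebraicClasses H 1 := by
  obtain ⟨-, hint, -, -, h11, -⟩ := id hMH
  refine lefschetzOneOne_rational_holds hH _ ?_ ?_
  · exact (isRationalClass_iff_of_markedSq hH hint _).2
      ⟨Pi.single (Sum.inr ()) 1, by rw [LinearEquiv.apply_symm_apply, ratCast_single_inr]⟩
  · -- `\overline{(x, 0)} = (x̄, 0)` (landed as `NikulinTwinTransport.HkLatticeWitt.star_sumElim`, theses cone of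
    -- another route — not imported)
    have hstar : star (Sum.elim x 0 : K3HilbertIndex → ℂ) = Sum.elim (star x) 0 := by
      funext i
      rcases i with i | i <;> simp
    refine (h11 _).2 ⟨?_, ?_⟩
    · rw [LinearEquiv.apply_symm_apply, k3HilbertForm_comm, k3HilbertForm_inl_delta]
    · rw [LinearEquiv.apply_symm_apply, hstar, k3HilbertForm_comm, k3HilbertForm_inl_delta]

/-- `e_δ ∈ N_ℚ(H)` for a fourfold marked with period `(x, 0)`. [cite: Beauville1983, §6 Prop. 6 and Remarque] -/
theorem single_inr_mem_ratNeronSeveri (hH : IsSmoothProjective 4 H) (hMH : MarkedK3Sq[H, φH, PH, Sum.elim x 0])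
    (hNH : ∀ v, v ∈ NH ↔ φH.symm (fun i => (v i : ℂ)) ∈ algebraicClasses H 1) :
    (Pi.single (Sum.inr ()) 1 : K3HilbertIndex → ℚ) ∈ NH := by
  rw [hNH, ratCast_single_inr]
  exact delta_mem_algebraicClasses hH hMH

/-- **`T_ℚ(H) ⊂ Λ_{K3,ℚ} ⊕ 0`**: a rational transcendental vector of a fourfold marked with period
`(x, 0)` has vanishing `δ`-coordinate (it is `q`-orthogonal to the algebraic `e_δ`, and `q(e_δ, t) = −2 t_δ`).
[cite: Beauville1983, §6 Prop. 6, §9 Lemme 1] -/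
theorem apply_inr_eq_zero_of_mem_ratTransc (hH : IsSmoothProjective 4 H)
    (hMH : MarkedK3Sq[H, φH, PH, Sum.elim x 0])
    (hNH : ∀ v, v ∈ NH ↔ φH.symm (fun i => (v i : ℂ)) ∈ algebraicClasses H 1)
    {t : K3HilbertIndex → ℚ} (ht : t ∈ (qQ).orthogonal NH) : t (Sum.inr ()) = 0 := by
  have h := (LinearMap.BilinForm.mem_orthogonal_iff.1 ht) _ (single_inr_mem_ratNeronSeveri hH hMH hNH)
  rw [qQ_single_inr_left] at h
  simpa using h

/-- A rational transcendental vector of a fourfold marked with period `(x, 0)` reads `(t|_{Λ_{K3}}, 0)` in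
`ℂ²³`. [cite: Beauville1983, §6 Prop. 6, §9 Lemme 1] -/
theorem ratCast_eq_sumElim_of_mem_ratTransc (hH : IsSmoothProjective 4 H)
    (hMH : MarkedK3Sq[H, φH, PH, Sum.elim x 0])
    (hNH : ∀ v, v ∈ NH ↔ φH.symm (fun i => (v i : ℂ)) ∈ algebraicClasses H 1)
    {t : K3HilbertIndex → ℚ} (ht : t ∈ (qQ).orthogonal NH) :
    (fun i => (t i : ℂ)) = Sum.elim (fun k => (t (Sum.inl k) : ℂ)) 0 := by
  funext i
  rcases i with k | u
  · rfl
  · obtain rfl : u = () := rfl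
    simp [apply_inr_eq_zero_of_mem_ratTransc hH hMH hNH ht]

/-! ### Rational descent of `ℂ`-linear maps and agreement on rational spans -/

/-- **A `ℂ`-linear map `ℂ^m → ℂ^n` carrying `ℚ^m` into `ℚ^n` is the complexification of a `ℚ`-linear
map** (pointwise choice; linearity by injectivity of `ℚ^n ⊂ ℂ^n`). [folklore] -/
theorem exists_ratLinear_of_forall_ratCast {m n : Type} [Fintype m] [Fintype n]
    (L : (m → ℂ) →ₗ[ℂ] (n → ℂ))
    (hL : ∀ v : m → ℚ, ∃ w : n → ℚ, L (fun i => (v i : ℂ)) = fun i => (w i : ℂ)) :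
    ∃ G : (m → ℚ) →ₗ[ℚ] (n → ℚ), ∀ v : m → ℚ, (fun i => ((G v) i : ℂ)) = L (fun i => (v i : ℂ)) := by
  choose t ht using hL
  have hinj : Function.Injective (fun w : n → ℚ => fun i => (w i : ℂ)) := fun a b h => by
    funext i
    have hi := congrFun h i
    simp only at hi
    exact_mod_cast hi
  have hadd : ∀ a b, t (a + b) = t a + t b := fun a b => hinj (by
    have h1 : (fun i => ((a + b) i : ℂ)) = (fun i => (a i : ℂ)) + fun i => (b i : ℂ) := by
      funext i; simp
    have h2 : (fun i => ((t a + t b) i : ℂ)) = (fun i => (t a i : ℂ)) + fun i => (t b i : ℂ) := by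
      funext i; simp
    simp only
    rw [← ht, h1, map_add, ht, ht, h2])
  have hsmul : ∀ (q : ℚ) a, t (q • a) = q • t a := fun q a => hinj (by
    have h1 : (fun i => ((q • a) i : ℂ)) = (q : ℂ) • fun i => (a i : ℂ) := by
      funext i; simp
    have h2 : (fun i => ((q • t a) i : ℂ)) = (q : ℂ) • fun i => (t a i : ℂ) := by
      funext i; simp
    simp only
    rw [← ht, h1, map_smul, ht, h2])
  exact ⟨{ toFun := t, map_add' := hadd, map_smul' := hsmul }, fun v => (ht v).symm⟩

/-- **Two `ℂ`-linear maps out of `ℂ^ι` which agree on the rational vectors of `R ⊆ ℚ^ι` agree on the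
complex span `R ⊗ ℂ`.** [folklore] -/
theorem eq_on_span_ratCast {ι : Type} {M : Type*} [AddCommGroup M] [Module ℂ M]
    (L L' : (ι → ℂ) →ₗ[ℂ] M) (R : Set (ι → ℚ))
    (h : ∀ r ∈ R, L (fun i => (r i : ℂ)) = L' (fun i => (r i : ℂ)))
    {y : ι → ℂ} (hy : y ∈ Submodule.span ℂ ((fun a : ι → ℚ => fun i => (a i : ℂ)) '' R)) :
    L y = L' y := by
  induction hy using Submodule.span_induction with
  | mem y' hy' =>
    obtain ⟨r, hr, rfl⟩ := hy'
    exact h r hr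
  | zero => rw [map_zero, map_zero]
  | add a b _ _ ha hb => rw [map_add, map_add, ha, hb]
  | smul c a _ ha => rw [map_smul, map_smul, ha]

/-! ### Complexified rational isometries of `(ℚ²³, q)` -/

/-- **The complexification of a rational `q`-isometry of `ℚ²³` is an isometry of `(ℂ²³, q)`** (the
bilinear identity holds on the rational standard basis). [cite: Huybrechts2016K3, Ch. 3 §2.2] -/
theorem k3HilbertForm_cplx_cplx (τ : (K3HilbertIndex → ℚ) →ₗ[ℚ] (K3HilbertIndex → ℚ))
    (hτ : ∀ v w, qQ (τ v) (τ w) = qQ v w) (a b : K3HilbertIndex → ℂ) :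
    k3HilbertForm 2 (cz[τ] a) (cz[τ] b) = k3HilbertForm 2 a b := by
  -- the two bilinear forms `q(cz a, cz b)` and `q(a, b)` agree on the standard basis
  set B₁ : LinearMap.BilinForm ℂ (K3HilbertIndex → ℂ) :=
    (Matrix.toBilin' (Matrix.map (k3HilbertGram 2) (Int.cast : ℤ → ℂ))).compl₁₂ cz[τ] cz[τ] with hB₁
  set B₂ : LinearMap.BilinForm ℂ (K3HilbertIndex → ℂ) :=
    Matrix.toBilin' (Matrix.map (k3HilbertGram 2) (Int.cast : ℤ → ℂ)) with hB₂
  have hB : B₁ = B₂ := by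
    refine (Pi.basisFun ℂ K3HilbertIndex).ext fun i => (Pi.basisFun ℂ K3HilbertIndex).ext fun j => ?_
    have hi : (Pi.basisFun ℂ K3HilbertIndex) i = fun k => ((Pi.single i (1 : ℚ) : K3HilbertIndex → ℚ) k : ℂ) := by
      funext k; by_cases hk : k = i <;> simp [Pi.basisFun_apply, hk]
    have hj : (Pi.basisFun ℂ K3HilbertIndex) j = fun k => ((Pi.single j (1 : ℚ) : K3HilbertIndex → ℚ) k : ℂ) := by
      funext k; by_cases hk : k = j <;> simp [Pi.basisFun_apply, hk]
    rw [hB₁, hB₂, LinearMap.compl₁₂_apply, hi, hj, cplx_ratCast, cplx_ratCast, qC_apply, qC_apply,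
      k3HilbertForm_ratCast, k3HilbertForm_ratCast, hτ]
  have h := LinearMap.congr_fun₂ hB a b
  rw [hB₁, hB₂, LinearMap.compl₁₂_apply, qC_apply, qC_apply] at h
  exact h

/-- `cz[τ⁻¹] (cz[τ] y) = y` for a `ℚ`-linear automorphism `τ` of `ℚ²³`. [folklore] -/
theorem cplx_symm_cplx (τ : (K3HilbertIndex → ℚ) ≃ₗ[ℚ] (K3HilbertIndex → ℚ)) (y : K3HilbertIndex → ℂ) :
    cz[(τ.symm : (K3HilbertIndex → ℚ) →ₗ[ℚ] (K3HilbertIndex → ℚ))]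
      (cz[(τ : (K3HilbertIndex → ℚ) →ₗ[ℚ] (K3HilbertIndex → ℚ))] y) = y :=
  cplx_cplx_of_mem_span (τ : (K3HilbertIndex → ℚ) →ₗ[ℚ] (K3HilbertIndex → ℚ))
    (τ.symm : (K3HilbertIndex → ℚ) →ₗ[ℚ] (K3HilbertIndex → ℚ)) ⊤ (fun r _ => τ.symm_apply_apply r)
    (by
      have : y ∈ Submodule.span ℂ (Set.range (Pi.basisFun ℂ K3HilbertIndex)) := by
        rw [(Pi.basisFun ℂ K3HilbertIndex).span_eq]; exact Submodule.mem_top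
      refine Submodule.span_mono ?_ this
      rintro _ ⟨i, rfl⟩
      exact ⟨Pi.single i 1, Submodule.mem_top, by
        funext k; by_cases hk : k = i <;> simp [Pi.basisFun_apply, hk]⟩)

/-- `cz[τ] (cz[τ⁻¹] y) = y` for a `ℚ`-linear automorphism `τ` of `ℚ²³`. [folklore] -/
theorem cplx_cplx_symm (τ : (K3HilbertIndex → ℚ) ≃ₗ[ℚ] (K3HilbertIndex → ℚ)) (y : K3HilbertIndex → ℂ) :
    cz[(τ : (K3HilbertIndex → ℚ) →ₗ[ℚ] (K3HilbertIndex → ℚ))]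
      (cz[(τ.symm : (K3HilbertIndex → ℚ) →ₗ[ℚ] (K3HilbertIndex → ℚ))] y) = y := by
  have h := cplx_symm_cplx τ.symm y
  rwa [LinearEquiv.symm_symm] at h

/-- The complexification of a `ℚ`-linear automorphism of `ℚ²³` is bijective. [folklore] -/
theorem cplx_bijective (τ : (K3HilbertIndex → ℚ) ≃ₗ[ℚ] (K3HilbertIndex → ℚ)) :
    Function.Bijective cz[(τ : (K3HilbertIndex → ℚ) →ₗ[ℚ] (K3HilbertIndex → ℚ))] :=
  ⟨fun a b h => by
      have h' := congrArg cz[(τ.symm : (K3HilbertIndex → ℚ) →ₗ[ℚ] (K3HilbertIndex → ℚ))] h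
      rwa [cplx_symm_cplx, cplx_symm_cplx] at h',
    fun y => ⟨_, cplx_cplx_symm τ y⟩⟩

end Summit.HodgeConjecture.HodgeConjecture.Theorems.MarkmanPartnerTransport.PartnerLattice

end
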